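import Literature.Analysis.FluidPDE.TorusNSVDataExistence
import Summits.AnomalousDissipation.AnomalousDissipation.Theorems.BaireTransferDenseLoudDesignerForcesErgodicLine

/-!
# Strong solutions of NS_ν(f_c) on `T³` from `V`-data, classical on `(0, T]`, attaining the datum in
# `H¹` (line `ergodic-budget-selection-closing`, crux `BaireTransfer.DenseLoudDesignerForces`,
# stmt-AnomalousDissipation-1143) — tools stub E7 of block N-E

Sorry-free Summit-side corollary of the landed Literature theorem
`Torus.IsClassicalNSSolutionOn.exists_forced_solution_of_eGradNormSq_le`
(`Literature/Analysis/FluidPDE/TorusNSVDataExistence.lean`): the model of block N of the line is built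
from solutions with `V`-data (`H¹`, not smooth), and this file constructs them for the phase space `H`
of the line (`Hsp`, `rep` of `…ErgodicLine`).

* `stub_vDataExistenceTools` (the registered tools stub, CORRECTED by the hypothesis `0 ≤ E₁`) — for
  `ν > 0`, the designer force `realTrigPoly S₀ Fc`, `L > 0`, a classical background solution `(ū, p̄)`
  on `[0, L] × T³` with mean-zero slices and a level `E₁ ≥ 0` there are
  `T ∈ (0, L]` and `Y` such that every state `v₀ ∈ H` with `‖∇v₀‖₂² ≤ E₁` (spectral enstrophy of a
  representative) is attained in `L²` and in `Ḣ¹` as `t → 0⁺` by a classical solution `(u, p)` of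
  NS_ν(f_c) on `(0, T] × T³` with mean-zero slices, `‖∇u(t)‖₂² ≤ 2E₁ + 2` and `∫ₛᵀ ‖Δu‖₂² ≤ Y`.

The hypothesis `0 ≤ E₁` is necessary: without it (any `E₁ : ℝ`) the statement is false for `E₁ < -1` —
`ENNReal.ofReal E₁ = 0` admits the datum `v₀ = 0`, while `‖∇u(T)‖₂² ≤ 2E₁ + 2 < 0` is impossible.
References: J. C. Robinson, J. L. Rodrigo, W. Sadowski, *The Three-Dimensional Navier–Stokes Equations* (CUP 2016), Thm 6.8 (local
strong solutions from `u₀ ∈ V` by Galerkin approximation), Thm 7.5 (smoothness for `t > 0`);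
P. Constantin, C. Foias, *Navier–Stokes Equations* (1988), Ch. 10.  Nothing is asserted; no definition
is added.
-/

-- `Summit.<Summit>.<Problem>` is the tree's mandated summit-side namespace (CONVENTIONS §2); for this
-- single-conjunct summit the two coincide, so the duplicate is deliberate.
set_option linter.dupNamespace false

noncomputable section

open Set Function MeasureTheory Filter
open scoped InnerProductSpace Topology ENNReal

namespace Summit.AnomalousDissipation.AnomalousDissipation.Theorems.DenseLoudDesignerForces.Ergodic

open Literature.Analysis.FunctionSpaces Literature.Analysis.FunctionSpaces.Torus
open Literature.Analysis.FluidPDE Literature.Analysis.FluidPDE.Torus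

/-- **Tools stub E7 (`stub_vDataExistenceTools`, with the hypothesis `0 ≤ E₁`) — strong solutions of
NS_ν(f_c) on `T³` from `V`-data by smooth approximation** (Robinson–Rodrigo–Sadowski 2016, Thm 6.8 with
Thm 7.5, for the forced system with the force absorbed by the background).  For `ν > 0`, the designer
force `realTrigPoly S₀ Fc`, `L > 0`, a classical solution `(ū, p̄)` of NS_ν(f_c) on `[0, L] × T³` with
mean-zero velocity slices and `E₁ ≥ 0`, there are `T` with `0 < T ≤ L` and `Y` such that for every
state `v₀ ∈ H` with `eGradNormSq (rep v₀) ≤ E₁` there is a classical solution `(u, p)` of NS_ν(f_c) on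
`(0, T] × T³` with mean-zero velocity slices, `‖∇u(t)‖₂² ≤ 2E₁ + 2` on `(0, T]`,
`∫ₛᵀ ‖Δu(t)‖₂² dt ≤ Y` for `s ∈ (0, T]`, `∫ ‖u(t) − rep v₀‖² → 0` and `‖∇(u(t) − rep v₀)‖₂² → 0`
(spectral) as `t → 0⁺`.  Proof: the Literature theorem at `d = Fin 3` — the force is a real trigonometric
polynomial, hence of finite Gevrey levels (`Torus.realTrigPoly_gevreyLevel_freqBall_le`), and a state of
`H` is represented by an `L²`, weakly divergence-free, mean-zero field (`Lp.memLp`,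
`Torus.isWeaklyDivFree_of_mem_energySpace`, `Torus.integral_eq_zero_of_mem_energySpace`).  The
incompressibility and zero mean of the force are not needed (they are carried for the registered shape).
[cite: RobinsonRodrigoSadowskiCUP2016, Thm 6.8 with Thm 7.5] -/
theorem stub_vDataExistenceTools {ν : ℝ} (hν : 0 < ν) (S₀ : Finset (Fin 3 → ℤ)) (Fc : (Fin 3 → ℤ) → EuclideanSpace ℂ (Fin 3))
    (hFdiv : IsDivFree (realTrigPoly S₀ Fc)) (hFmean : HasZeroMean (realTrigPoly S₀ Fc)) {L : ℝ} (hL : 0 < L)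
    {ū : ℝ → (UnitAddTorus (Fin 3)) → (EuclideanSpace ℝ (Fin 3))} {pbar : ℝ → (UnitAddTorus (Fin 3)) → ℝ}
    (hū : IsClassicalNSSolutionOn (Icc 0 L) ν (fun _ => realTrigPoly S₀ Fc) ū pbar) (hūmean : ∀ t ∈ Icc 0 L, HasZeroMean (ū t))
    (E₁ : ℝ) (hE₁ : 0 ≤ E₁) :
    ∃ T Y : ℝ, 0 < T ∧ T ≤ L ∧ ∀ v₀ : Hsp, eGradNormSq (rep v₀) ≤ ENNReal.ofReal E₁ →
      ∃ (u : ℝ → (UnitAddTorus (Fin 3)) → (EuclideanSpace ℝ (Fin 3))) (p : ℝ → (UnitAddTorus (Fin 3)) → ℝ),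
        IsClassicalNSSolutionOn (Ioc 0 T) ν (fun _ => realTrigPoly S₀ Fc) u p ∧ (∀ t ∈ Ioc 0 T, HasZeroMean (u t)) ∧
        (∀ t ∈ Ioc 0 T, gradNormSq (u t) ≤ 2 * E₁ + 2) ∧ (∀ s ∈ Ioc 0 T, ∫ t in s..T, (∫ x, ‖laplacian (u t) x‖ ^ 2) ≤ Y) ∧
        Tendsto (fun t => ∫ x, ‖u t x - rep v₀ x‖ ^ 2) (𝓝[>] 0) (𝓝 0) ∧
        Tendsto (fun t => eGradNormSq (u t - rep v₀)) (𝓝[>] 0) (𝓝 0) := by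
  -- the registered shape carries `IsDivFree`/`HasZeroMean` of the force, which the Literature theorem
  -- does not need (the force enters only through the background solution `ū` and its Gevrey levels)
  have _ : IsDivFree (realTrigPoly S₀ Fc) ∧ HasZeroMean (realTrigPoly S₀ Fc) := ⟨hFdiv, hFmean⟩
  have hF : ∀ τ : ℝ, ∃ G : ℝ, ∀ R : ℕ, ∑ k ∈ freqBall R, Real.exp (τ * Real.sqrt (freqNormSq k)) ^ 2 *
      (freqNormSq k * ‖UnitAddTorus.mFourierCoeff (EuclideanSpace.complexify ∘ realTrigPoly S₀ Fc) k‖ ^ 2) ≤ G :=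
    fun τ => ⟨_, fun R => realTrigPoly_gevreyLevel_freqBall_le S₀ Fc τ R⟩
  obtain ⟨T, Y, hT, hTL, h⟩ :=
    hū.exists_forced_solution_of_eGradNormSq_le (Fintype.card_fin 3) hν hF hL hūmean hE₁
  exact ⟨T, Y, hT, hTL, fun v₀ hv₀ => h (rep v₀) (Lp.memLp v₀.1) (isWeaklyDivFree_of_mem_energySpace v₀.2)
    (integral_eq_zero_of_mem_energySpace v₀.2) hv₀⟩

end Summit.AnomalousDissipation.AnomalousDissipation.Theorems.DenseLoudDesignerForces.Ergodic

end
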